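import Literature.MathematicalPhysics.QuantumFieldTheory.Balaban1983to89.B9Eq335CoverageAtLettersY

/-!
# `Balaban1983to89.B9Eq335CoverageWindow` — T. Bałaban, *Propagators and renormalization transformations for lattice gauge theories. II*, Commun. Math. Phys. **96**
# (1984) 223–250 [Balaban1984PropagatorsII] (2.1)–(2.2) p. 224 read on def-Y's k-level members: THE GEOMETRY BEHIND «every bond of Ω_j lies in a cube of the class»
# — aligned torus cubes containing the plaquettes based in a big block, the torus sup-distance inside a cube, and the LEVEL WINDOW `|lev y − lev x| ≤ 1` on a cube
# of `n` big `(lev x)`-blocks from the collar axiom (2.2) when `n·L ≤ R` (class-independent core of this seat's coverage lemma for [Balaban1985BackgroundPropagators] p. 396 ∕ p. 404)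

statement-level skeleton of published theorems with citation tags; proofs where landed; nothing here is a claim about the Yang–Mills mass gap

THE PRINT.  [4] p. 224, (2.1): *«Ω₁ ⊃ Ω₂ ⊃ … ⊃ Ω_k, Ω_j = Bʲ(Ω_j^{(j)}) … a sum of big blocks»*; (2.2): *«(Lʲη)⁻¹ dist(Ω_jᶜ, Ω_{j+1}) > RM»*.  [B9] p. 396: the cube class of (3.35)
(«□ ⊂ Bʲ(Λ_j) ∪ B^{j+1}(Λ_{j+1}), □ ∩ Bʲ(Λ_j) ≠ ∅, … a union of several big blocks … O(1) ≧ 10»); p. 404: (3.69) for «b ∈ Ω_j» «directly from the assumptions (3.35)».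

WHY THIS FILE (cell context).  This seat's LOCATED-COVERAGE-1 and the dag-lead DESK WORD made the COVERAGE of plaquettes by the (3.35) cube class this seat's item;
node00-def-Y g7 (R289) re-typed print's class as `B9BackgroundsKLevelV1P.cubeClassP` (sizes `n ≧ 10` open-ended, per-cube constant, level window `{j, j+1}`, p531304).
The coverage proof needs three class-independent geometric facts on def-Y's carriers (`torusCube`, `levV1`, the box chart `toBox`, `TDomains.sepT`), proved here;
the class-specific assembly is `B9Eq335CoveragePAtLettersY`.
WHAT IS PROVED (sorry-free; 0 `def`).
* A. `shift_mem_torusCube_succ` (`x ∈ torusCube c s ⇒ x + e_μ ∈ torusCube c (s+1)`, wrap-around included), ★ `plaquette_mem_torusCube_two_mul` (`s ≥ 2`, `x ∈ torusCube c s` ⇒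
  `x, x+e_μ, x+e_ν, x+e_μ+e_ν ∈ torusCube c (2s)`).
* B. ★ `torusSupNorm_lt_of_mem_torusCube` (two sites of `torusCube c D` are at torus sup-distance `< D` in NODE 00's box chart: `circAbs` depends only on the residue,
  `B4TorusKernel.MultiPeriod.circAbs_le_abs`).
* C. ★★ `levV1_window` (`x, y ∈ torusCube c (n·bigSide(lev x))`, `n·L ≤ R` ⇒ `lev x − 1 ≤ lev y ≤ lev x + 1`, from `TDomains.sepT` at levels `lev x ± 1`), `levV1_window_two`
  (`n = 2`, hypothesis-free since `2L ≤ 2L² ≤ R` = `KIdx.hR2`).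
HONEST SCOPE.  Lattice geometry bookkeeping on def-Y's typed (2.1)–(2.2); count-neutral; NOT a node discharge; nothing continuum ∕ OS ∕ mass gap ∕ Clay.  Cell `pub-ymgap`
(HUMAN RULING D-0062), Track A node N06 [B9], seat `pub-ymgap-dag-n06-j` (bundle F5; harness re-seat gen 11), 2026-08-27.  NEW file importing this seat's
`B9Eq335CoverageAtLettersY`; nothing landed is modified.  Net new unproved facts: 0.
-/

noncomputable section

namespace Literature.MathematicalPhysics.QuantumFieldTheory.Balaban1983to89.B9Eq335CoverageWindow

open Literature.MathematicalPhysics.QuantumFieldTheory.Balaban1983to89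
open B6KLevelCensusIndexV1 B9BackgroundsKLevelV1 B6GlobalChartV1 Node00
open scoped Matrix

section Geometry

variable {d ℓ : ℕ} {hd : 1 ≤ d + 1} {hL : Odd (ℓ + 1) ∧ 1 < ℓ + 1} {b₀ b₁ : ℝ}
variable (i : KIdx d ℓ hd hL b₀ b₁)

/-! ### A. The doubled cube around a block contains the plaquettes based in the block -/

/-- one lattice step from a cube of side `s` stays in the cube of side `s + 1` with the same corner. [cite: Balaban1985BackgroundPropagators, p.396 (cubes of the class), bookkeeping] -/
theorem shift_mem_torusCube_succ {P : Params} {c x : Site P 0} {s : ℕ} (hx : x ∈ torusCube c s) (μ : Fin P.d) :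
    x.shift μ ∈ torusCube c (s + 1) := by
  intro ν
  by_cases hν : ν = μ
  · subst hν
    have h1 : (x.shift ν) ν - c ν = (x ν - c ν) + 1 := by simp [Site.shift]; ring
    rw [h1, ZMod.val_add, ZMod.val_one]
    exact lt_of_le_of_lt (Nat.mod_le _ _) (Nat.succ_lt_succ (hx ν))
  · have h1 : (x.shift μ) ν = x ν := by simp [Site.shift, Function.update_of_ne hν]
    rw [h1]
    exact Nat.lt_succ_of_lt (hx ν)

/-- hence `x`, `x + e_μ`, `x + e_μ + e_ν` all lie in the DOUBLED cube `torusCube c (2s)` when `x ∈ torusCube c s`, `s ≥ 2`.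
[cite: Balaban1985BackgroundPropagators, p.396, bookkeeping] -/
theorem plaquette_mem_torusCube_two_mul {P : Params} {c x : Site P 0} {s : ℕ} (hs : 2 ≤ s) (hx : x ∈ torusCube c s) (μ ν : Fin P.d) :
    x ∈ torusCube c (2 * s) ∧ x.shift μ ∈ torusCube c (2 * s) ∧ x.shift ν ∈ torusCube c (2 * s) ∧ (x.shift μ).shift ν ∈ torusCube c (2 * s) :=
  ⟨torusCube_mono c (by omega) hx, torusCube_mono c (by omega) (shift_mem_torusCube_succ hx μ),
    torusCube_mono c (by omega) (shift_mem_torusCube_succ hx ν),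
    torusCube_mono c (by omega) (shift_mem_torusCube_succ (shift_mem_torusCube_succ hx μ) ν)⟩

/-! ### B. Two sites of one coordinate cube are close in the torus metric -/

/-- `circAbs` only depends on the residue. [folklore] -/
private theorem circAbs_congr {N : ℕ} {u w : ℤ} (h : u % (N : ℤ) = w % (N : ℤ)) :
    B4TorusKernel.MultiPeriod.circAbs N u = B4TorusKernel.MultiPeriod.circAbs N w := by
  unfold B4TorusKernel.MultiPeriod.circAbs; rw [h]

/-- ★ two sites of a torus cube of side `D` are at torus sup-distance `< D` (read in NODE 00's box chart). [cite: Balaban1984PropagatorsII, (2.2) p.224 (the torus distance), bookkeeping] -/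
theorem torusSupNorm_lt_of_mem_torusCube {c y y' : Site (PV d ℓ i.m i.K hd hL) 0} {D : ℕ} (hy : y ∈ torusCube c D) (hy' : y' ∈ torusCube c D) :
    B4TorusKernel.MultiPeriod.torusSupNorm (B6MultiLevelBoxOperator.N0 ℓ i.Mh i.k i.P')
      ((toBox i.hN y : Fin (d + 1) → ℤ) - (toBox i.hN y' : Fin (d + 1) → ℤ)) < D := by
  unfold B4TorusKernel.MultiPeriod.torusSupNorm
  rw [Finset.sup'_lt_iff]
  intro μ _
  rw [Pi.sub_apply, toBox_apply, toBox_apply, i.hN μ]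
  set N := (PV d ℓ i.m i.K hd hL).sitesPerDir 0 with hNdef
  have haD : (y μ - c μ).val < D := hy μ
  have haD' : (y' μ - c μ).val < D := hy' μ
  -- `(y μ).val − (y′ μ).val ≡ a − a′ (mod N)`
  have hmod : (((y μ).val : ℤ) - ((y' μ).val : ℤ)) % (N : ℤ) = ((((y μ - c μ).val : ℕ) : ℤ) - (((y' μ - c μ).val : ℕ) : ℤ)) % (N : ℤ) := by
    rw [← ZMod.intCast_eq_intCast_iff']
    push_cast
    rw [ZMod.natCast_zmod_val, ZMod.natCast_zmod_val, ZMod.natCast_zmod_val, ZMod.natCast_zmod_val]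
    ring
  rw [circAbs_congr hmod]
  have hN1 : 1 ≤ N := Nat.one_le_iff_ne_zero.2 ((PV d ℓ i.m i.K hd hL).sitesPerDir_ne_zero 0)
  have habs : |(((y μ - c μ).val : ℕ) : ℤ) - (((y' μ - c μ).val : ℕ) : ℤ)| < D := by
    rw [abs_lt]; constructor <;> omega
  calc ((B4TorusKernel.MultiPeriod.circAbs N ((((y μ - c μ).val : ℕ) : ℤ) - (((y' μ - c μ).val : ℕ) : ℤ)) : ℤ) : ℝ)
      ≤ ((|(((y μ - c μ).val : ℕ) : ℤ) - (((y' μ - c μ).val : ℕ) : ℤ)| : ℤ) : ℝ) := by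
        exact_mod_cast B4TorusKernel.MultiPeriod.circAbs_le_abs hN1 _
    _ < D := by exact_mod_cast habs

/-! ### C. The level window on the doubled cube, from the collar axiom (2.2) -/

/-- `bigSide (j+1) = bigSide j · L`. [cite: Balaban1984PropagatorsII, (2.1) p.224, bookkeeping] -/
private theorem bigSide_succ (Mh j : ℕ) : B6MultiLevelBoxOperator.bigSide ℓ Mh (j + 1) = B6MultiLevelBoxOperator.bigSide ℓ Mh j * (ℓ + 1) := by
  simp [B6MultiLevelBoxOperator.bigSide, pow_succ]; ring

/-- ★★ **LEVEL WINDOW FROM THE COLLAR AXIOM (2.2)**: if `x, y` lie in one torus cube of side `n·bigSide(lev x)` with `n·L ≤ R`, then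
`lev x − 1 ≤ lev y ≤ lev x + 1` — a level jump of `2` across a torus distance `< n·M·L^{lev x}` is excluded by `TDomains.sepT` (for `n = 2` the hypothesis
`2L ≤ R` is automatic from `KIdx.hR2 : 2L² ≤ R`; for print's `n = 12` it reads `12L ≤ R`). [cite: Balaban1984PropagatorsII, (2.2) p.224; Balaban1985BackgroundPropagators, p.396, p.409] -/
theorem levV1_window {n : ℕ} (hn : n * (ℓ + 1) ≤ i.R) {c x y : Site (PV d ℓ i.m i.K hd hL) 0}
    (hx : x ∈ torusCube c (n * B6MultiLevelBoxOperator.bigSide ℓ i.Mh (levV1 i x)))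
    (hy : y ∈ torusCube c (n * B6MultiLevelBoxOperator.bigSide ℓ i.Mh (levV1 i x))) :
    levV1 i x ≤ levV1 i y + 1 ∧ levV1 i y ≤ levV1 i x + 1 := by
  have hℓ : 4 ≤ ℓ := i.hℓ
  have hxlev : i.D.lev (toBox i.hN x).1 = levV1 i x := rfl
  have hylev : i.D.lev (toBox i.hN y).1 = levV1 i y := rfl
  have dxy := torusSupNorm_lt_of_mem_torusCube i hx hy
  have dyx := torusSupNorm_lt_of_mem_torusCube i hy hx
  constructor
  · -- `lev y ≥ lev x − 1`: otherwise `sepT (lev x − 1)` between `y` and `x`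
    by_contra hlt
    push Not at hlt
    have hsep := i.D.sepT (levV1 i x - 1) (toBox i.hN y).1 (toBox i.hN y).2 (toBox i.hN x).1 (toBox i.hN x).2
      (by rw [hylev]; omega) (by rw [hxlev]; omega)
    have hlt2 := lt_trans hsep dyx
    have hlt3 : i.R * B6MultiLevelBoxOperator.bigSide ℓ i.Mh (levV1 i x - 1) < n * B6MultiLevelBoxOperator.bigSide ℓ i.Mh (levV1 i x) := by
      exact_mod_cast hlt2
    have hS : B6MultiLevelBoxOperator.bigSide ℓ i.Mh (levV1 i x) = B6MultiLevelBoxOperator.bigSide ℓ i.Mh (levV1 i x - 1) * (ℓ + 1) := by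
      rw [← bigSide_succ]; congr 1; omega
    rw [hS] at hlt3
    have h1 : n * (ℓ + 1) * B6MultiLevelBoxOperator.bigSide ℓ i.Mh (levV1 i x - 1) ≤ i.R * B6MultiLevelBoxOperator.bigSide ℓ i.Mh (levV1 i x - 1) :=
      Nat.mul_le_mul_right _ hn
    have h2 : n * (B6MultiLevelBoxOperator.bigSide ℓ i.Mh (levV1 i x - 1) * (ℓ + 1)) = n * (ℓ + 1) * B6MultiLevelBoxOperator.bigSide ℓ i.Mh (levV1 i x - 1) := by
      ring
    omega
  · -- `lev y ≤ lev x + 1`: otherwise `sepT (lev x + 1)` between `x` and `y`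
    by_contra hlt
    push Not at hlt
    have hsep := i.D.sepT (levV1 i x + 1) (toBox i.hN x).1 (toBox i.hN x).2 (toBox i.hN y).1 (toBox i.hN y).2
      (by rw [hxlev]; omega) (by rw [hylev]; omega)
    have hlt2 := lt_trans hsep dxy
    have hlt3 : i.R * B6MultiLevelBoxOperator.bigSide ℓ i.Mh (levV1 i x + 1) < n * B6MultiLevelBoxOperator.bigSide ℓ i.Mh (levV1 i x) := by
      exact_mod_cast hlt2
    rw [bigSide_succ] at hlt3
    have h1 : n * (ℓ + 1) * (B6MultiLevelBoxOperator.bigSide ℓ i.Mh (levV1 i x) * (ℓ + 1)) ≤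
        i.R * (B6MultiLevelBoxOperator.bigSide ℓ i.Mh (levV1 i x) * (ℓ + 1)) := Nat.mul_le_mul_right _ hn
    have h3 : 1 ≤ (ℓ + 1) * (ℓ + 1) := Nat.one_le_iff_ne_zero.2 (by positivity)
    have h2 : n * B6MultiLevelBoxOperator.bigSide ℓ i.Mh (levV1 i x) ≤ n * (ℓ + 1) * (B6MultiLevelBoxOperator.bigSide ℓ i.Mh (levV1 i x) * (ℓ + 1)) := by
      calc n * B6MultiLevelBoxOperator.bigSide ℓ i.Mh (levV1 i x) = n * B6MultiLevelBoxOperator.bigSide ℓ i.Mh (levV1 i x) * 1 := by ring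
        _ ≤ n * B6MultiLevelBoxOperator.bigSide ℓ i.Mh (levV1 i x) * ((ℓ + 1) * (ℓ + 1)) := Nat.mul_le_mul_left _ h3
        _ = n * (ℓ + 1) * (B6MultiLevelBoxOperator.bigSide ℓ i.Mh (levV1 i x) * (ℓ + 1)) := by ring
    omega

/-- the case `n = 2` (the doubled cube), hypothesis-free: `2L ≤ 2L² ≤ R`. [cite: Balaban1984PropagatorsII, (2.2) p.224] -/
theorem levV1_window_two {c x y : Site (PV d ℓ i.m i.K hd hL) 0}
    (hx : x ∈ torusCube c (2 * B6MultiLevelBoxOperator.bigSide ℓ i.Mh (levV1 i x)))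
    (hy : y ∈ torusCube c (2 * B6MultiLevelBoxOperator.bigSide ℓ i.Mh (levV1 i x))) :
    levV1 i x ≤ levV1 i y + 1 ∧ levV1 i y ≤ levV1 i x + 1 :=
  levV1_window i (n := 2) (le_trans (by nlinarith [i.hℓ]) i.hR2) hx hy

end Geometry

end Literature.MathematicalPhysics.QuantumFieldTheory.Balaban1983to89.B9Eq335CoverageWindow
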